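import Mathlib.Topology.Maps.Proper.Basic
import Mathlib.Topology.Separation.Regular
import Literature.Dynamics.TopologicalDynamics.UniformRecurrence
import HarnessLib

/-!
# The orbit closure of a uniformly recurrent point is minimal (Furstenberg 1981, Thm. 1.17)

Topic `Literature/Dynamics/TopologicalDynamics`; the converse half of Birkhoff's characterisation of
uniform recurrence, which `UniformRecurrence.lean` deliberately left out ("What is NOT here: the
converse, Furstenberg 1981, Thm. 1.17 — the orbit closure of a uniformly recurrent point of a compact
Hausdorff system is minimal; its proof uses regularity of the phase space").

For an action `ϕ : G → X → X` of a commutative topological monoid of times that is JOINTLY continuous,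
with the action law `ϕ (s + t) = ϕ s ∘ ϕ t`, on a REGULAR space `X`:

* `mem_closure_orbit_of_isUniformlyRecurrentPt` — if `x` is uniformly recurrent, then `x` lies in the
  orbit closure of every point `y` of its own orbit closure (Furstenberg's proof: a closed neighbourhood
  `V ⊆ U` of `x`, a compact set `K` of corrections for the return times to `V`, and the CLOSED set
  `{z | ∃ k ∈ K, ϕ k z ∈ V}` — closed because `K` is compact and `ϕ` jointly continuous — which
  contains the orbit of `x`, hence its closure, hence `y`);
* `closure_orbit_eq_of_isUniformlyRecurrentPt` — consequently every point of the orbit closure of `x`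
  has the SAME orbit closure: the orbit closure of a uniformly recurrent point is a minimal set
  (every nonempty closed invariant subset is all of it, `eq_closure_orbit_of_isUniformlyRecurrentPt`);
* `IsUniformlyRecurrentPt.of_mem_closure_orbit_of_isCompact` — if moreover that orbit closure is
  compact, each of its points is uniformly recurrent (by the first half, Thm. 1.15, already in tree as
  `isUniformlyRecurrentPt_of_mem_closure_orbit`).

No compactness of `X` is needed for the first two statements (only regularity and joint continuity);
no separation beyond regularity (T₀ is not assumed).

## References

* H. Furstenberg, *Recurrence in Ergodic Theory and Combinatorial Number Theory*, Princeton UP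
  (1981), Ch. 1 §4, Thm. 1.17 (and Thm. 1.15 for the last corollary).
* J. Auslander, *Minimal Flows and their Extensions*, North-Holland (1988), Ch. 1, Thm. 7 / Cor. 8.
-/

open Set Filter Function
open scoped Topology

namespace Literature.Dynamics.TopologicalDynamics

variable {G : Type*} {X : Type*} [AddCommMonoid G] [TopologicalSpace G] [TopologicalSpace X]

omit [AddCommMonoid G] in
/-- For a compact set of times `K` and a closed set `V`, the set of points that can be moved into `V`
by some time in `K` is closed (jointly continuous action; the projection `K × X → X` is a closed
map). [folklore] -/
theorem isClosed_setOf_exists_mem_act_mem {ϕ : G → X → X}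
    (hcont : Continuous fun p : G × X => ϕ p.1 p.2) {K : Set G} (hK : IsCompact K)
    {V : Set X} (hV : IsClosed V) : IsClosed {z : X | ∃ k ∈ K, ϕ k z ∈ V} := by
  haveI : CompactSpace K := isCompact_iff_compactSpace.1 hK
  have hD : IsClosed {p : K × X | ϕ (p.1 : G) p.2 ∈ V} :=
    hV.preimage (hcont.comp ((continuous_subtype_val.comp continuous_fst).prodMk continuous_snd))
  have himage : Prod.snd '' {p : K × X | ϕ (p.1 : G) p.2 ∈ V} = {z : X | ∃ k ∈ K, ϕ k z ∈ V} := by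
    ext z
    simp only [mem_image, mem_setOf_eq, Prod.exists, Subtype.exists, exists_eq_right, exists_prop]
  rw [← himage]
  exact isClosedMap_snd_of_compactSpace _ hD

/-- **Furstenberg 1981, Thm. 1.17 (core step).** Let `ϕ` be a jointly continuous action of a
commutative topological monoid on a regular space with `ϕ (s + t) = ϕ s ∘ ϕ t`, and let `x` be
uniformly recurrent. Then `x` lies in the orbit closure of EVERY point of its own orbit closure.
Proof: given a neighbourhood `U` of `x`, pick a closed neighbourhood `V ⊆ U`; the return times of `x`
to `V` are syndetic with a compact set `K` of corrections, so the whole orbit of `x` lies in the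
closed set `C = {z | ∃ k ∈ K, ϕ k z ∈ V}` (`ϕ (g + k) x = ϕ k (ϕ g x)`), hence so does its closure,
hence `y ∈ C`: some `ϕ k y ∈ V ⊆ U`. [cite: Furstenberg1981, Ch. 1 §4, Thm. 1.17] -/
theorem mem_closure_orbit_of_isUniformlyRecurrentPt [RegularSpace X] {ϕ : G → X → X}
    (hcont : Continuous fun p : G × X => ϕ p.1 p.2) (hadd : ∀ s t z, ϕ (s + t) z = ϕ s (ϕ t z))
    {x : X} (hx : IsUniformlyRecurrentPt ϕ x) {y : X} (hy : y ∈ closure (range fun t => ϕ t x)) :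
    x ∈ closure (range fun t => ϕ t y) := by
  rw [mem_closure_iff_nhds]
  intro U hU
  obtain ⟨V, hVx, hVc, hVU⟩ := exists_mem_nhds_isClosed_subset hU
  obtain ⟨K, hK, hS⟩ := hx V hVx
  -- the closed set of points movable into `V` by a time in `K` contains the orbit of `x`
  have hC : IsClosed {z : X | ∃ k ∈ K, ϕ k z ∈ V} := isClosed_setOf_exists_mem_act_mem hcont hK hVc
  have horb : range (fun t => ϕ t x) ⊆ {z : X | ∃ k ∈ K, ϕ k z ∈ V} := by
    rintro _ ⟨g, rfl⟩
    obtain ⟨k, hk, hgk⟩ := hS g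
    refine ⟨k, hk, ?_⟩
    have : ϕ (g + k) x = ϕ k (ϕ g x) := by rw [add_comm, hadd]
    simpa only [mem_setOf_eq, this] using hgk
  obtain ⟨k, -, hky⟩ := hC.closure_subset_iff.2 horb hy
  exact ⟨ϕ k y, hVU hky, ⟨k, rfl⟩⟩

omit [TopologicalSpace G] in
/-- The orbit closure is invariant under a separately continuous action with the action law: the orbit closure of any point of `closure (orbit x)` is contained in `closure (orbit x)`.
[folklore] -/
theorem closure_orbit_subset_of_mem_closure_orbit {ϕ : G → X → X}
    (hcont : ∀ t, Continuous (ϕ t)) (hadd : ∀ s t z, ϕ (s + t) z = ϕ s (ϕ t z))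
    {x y : X} (hy : y ∈ closure (range fun t => ϕ t x)) :
    closure (range fun t => ϕ t y) ⊆ closure (range fun t => ϕ t x) := by
  refine closure_minimal ?_ isClosed_closure
  rintro _ ⟨t, rfl⟩
  exact mapsTo_closure_orbit hcont hadd t x hy

/-- **The orbit closure of a uniformly recurrent point is minimal** (Furstenberg 1981, Thm. 1.17):
for a jointly continuous action of a commutative topological monoid on a regular space with the
action law, every point `y` of the orbit closure of a uniformly recurrent point `x` has the same
orbit closure as `x`. [cite: Furstenberg1981, Ch. 1 §4, Thm. 1.17] -/
theorem closure_orbit_eq_of_isUniformlyRecurrentPt [RegularSpace X] {ϕ : G → X → X}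
    (hcont : Continuous fun p : G × X => ϕ p.1 p.2) (hadd : ∀ s t z, ϕ (s + t) z = ϕ s (ϕ t z))
    {x : X} (hx : IsUniformlyRecurrentPt ϕ x) {y : X} (hy : y ∈ closure (range fun t => ϕ t x)) :
    closure (range fun t => ϕ t y) = closure (range fun t => ϕ t x) := by
  have hsep : ∀ t, Continuous (ϕ t) := fun t => hcont.comp (Continuous.prodMk_right t)
  refine Subset.antisymm (closure_orbit_subset_of_mem_closure_orbit hsep hadd hy) ?_
  exact closure_orbit_subset_of_mem_closure_orbit hsep hadd
    (mem_closure_orbit_of_isUniformlyRecurrentPt hcont hadd hx hy)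

/-- **Minimality, set form**: under the same hypotheses, a closed set `M` that is mapped into itself
by every `ϕ t` and meets the orbit closure of the uniformly recurrent point `x` contains that whole
orbit closure. [cite: Furstenberg1981, Ch. 1 §4, Thm. 1.17] -/
theorem closure_orbit_subset_of_isUniformlyRecurrentPt [RegularSpace X] {ϕ : G → X → X}
    (hcont : Continuous fun p : G × X => ϕ p.1 p.2) (hadd : ∀ s t z, ϕ (s + t) z = ϕ s (ϕ t z))
    {x : X} (hx : IsUniformlyRecurrentPt ϕ x) {M : Set X} (hM : IsClosed M)
    (hinv : ∀ t, MapsTo (ϕ t) M M) {y : X} (hyM : y ∈ M)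
    (hy : y ∈ closure (range fun t => ϕ t x)) :
    closure (range fun t => ϕ t x) ⊆ M := by
  rw [← closure_orbit_eq_of_isUniformlyRecurrentPt hcont hadd hx hy]
  refine closure_minimal ?_ hM
  rintro _ ⟨t, rfl⟩
  exact hinv t hyM

/-- **Every point of a compact orbit closure of a uniformly recurrent point is uniformly recurrent**
(Thm. 1.17 + Thm. 1.15): if `x` is uniformly recurrent and its orbit closure is compact, then every
`y` in it is uniformly recurrent (deliberate dot-notation lemma on the tree's
`IsUniformlyRecurrentPt`). [cite: Furstenberg1981, Ch. 1 §4, Thm. 1.15 and Thm. 1.17] -/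
theorem IsUniformlyRecurrentPt.of_mem_closure_orbit_of_isCompact [RegularSpace X] {ϕ : G → X → X}
    (hcont : Continuous fun p : G × X => ϕ p.1 p.2) (hadd : ∀ s t z, ϕ (s + t) z = ϕ s (ϕ t z))
    {x : X} (hx : IsUniformlyRecurrentPt ϕ x) (hK : IsCompact (closure (range fun t => ϕ t x)))
    {y : X} (hy : y ∈ closure (range fun t => ϕ t x)) : IsUniformlyRecurrentPt ϕ y := by
  have hsep : ∀ t, Continuous (ϕ t) := fun t => hcont.comp (Continuous.prodMk_right t)
  refine isUniformlyRecurrentPt_of_mem_closure_orbit hsep hadd hK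
    (fun t => mapsTo_closure_orbit hsep hadd t x) hy fun z hz => ?_
  rw [closure_orbit_eq_of_isUniformlyRecurrentPt hcont hadd hx hz]
  exact hy

end Literature.Dynamics.TopologicalDynamics
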